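import Mathlib.Analysis.Normed.Field.Ultra
import HarnessLib

/-!
# Route `TameQuarticSolvent`, crux `SolventPairLowerBound` (stmt-BirchSwinnertonDyer-21391) — Newton-polygon SLOPES
# of a quartic `c₄x⁴ + c₃x³ + c₂x² + c₁x + c₀` with `‖c₄‖ = ϱ⁴`, `‖c₀‖ = 1` over an ultrametric field
# (the shape of the `3`-division polynomial `Ψ₃` on the (t′) good model)

HONEST FRAMING. Theorems only; helper (`--supports stmt-BirchSwinnertonDyer-21391 --as helper`) of width seat
bsd-wall-tqs-p1-w2 g7; pure ultrametric algebra feeding the point-level `3`-torsion valuation profile of the (t′)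
good model (sequel file `TameQuarticSolventTprimeThreeTorsionValuationAtThree`). BSD is not proved by any of this;
nothing here closes 21391 or 23963. No definition, no named fact.

WHAT (`K` any normed field with `IsUltrametricDist`, `0 < ϱ < 1`, root `x` of
`c₄x⁴ + c₃x³ + c₂x² + c₁x + c₀` with `‖c₄‖ = ϱ⁴`, `‖c₂‖, ‖c₁‖ ≤ ϱ⁴`, `‖c₀‖ = 1`):
* `norm_mul_eq_one_of_quartic_root_oneSlope` — `‖c₃‖ ≤ ϱ⁴` ⇒ **`‖x‖·ϱ = 1`** (one segment `(0,0) — (4, 4v(ϖ))`);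
* `norm_mul_eq_one_or_of_quartic_root_twoSlopes` — `‖c₃‖ = ϱ²` ⇒ **`‖x‖·ϱ² = 1 ∨ ‖x‖³·ϱ² = 1`** (vertices
  `(0,0)`, `(3, 2v(ϖ))`, `(4, 4v(ϖ))`);
with the two-line tools `norm_add₄_le` (four terms under a common bound) and `add_ne_zero_of_norm_lt` (an
isolated dominant term makes a sum nonzero).

References: standard Newton-polygon reasoning (e.g. N. Koblitz, *p-adic Numbers, p-adic Analysis, and
Zeta-Functions*, GTM 58, IV.3); J.-P. Serre, Invent. Math. 15 (1972) §1. [folklore]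
-/

-- D-0017: single-problem summit, so `Summit.BirchSwinnertonDyer.BirchSwinnertonDyer.…` repeats a namespace BY DESIGN.
set_option linter.dupNamespace false

noncomputable section

namespace Summit.BirchSwinnertonDyer.BirchSwinnertonDyer.Theorems.SolventPairLowerBound

/-! ## §1. Newton polygon of a quartic `c₄x⁴ + c₃x³ + c₂x² + c₁x + c₀` with `‖c₄‖ = ϱ⁴`, `‖c₀‖ = 1` -/

section Quartic

variable {K : Type*} [NormedField K] [IsUltrametricDist K]

/-- Four terms each of norm `≤ B` sum to norm `≤ B` (ultrametric). [folklore] -/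
theorem norm_add₄_le {a b c d : K} {B : ℝ} (ha : ‖a‖ ≤ B) (hb : ‖b‖ ≤ B) (hc : ‖c‖ ≤ B) (hd : ‖d‖ ≤ B) :
    ‖a + b + c + d‖ ≤ B :=
  (IsUltrametricDist.norm_add_le_max _ _).trans (max_le ((IsUltrametricDist.norm_add_le_max _ _).trans
    (max_le ((IsUltrametricDist.norm_add_le_max _ _).trans (max_le ha hb)) hc)) hd)

omit [IsUltrametricDist K] in
/-- A sum `e + s` with `‖s‖ < ‖e‖` is nonzero. [folklore] -/
theorem add_ne_zero_of_norm_lt {e s : K} (h : ‖s‖ < ‖e‖) : e + s ≠ 0 := by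
  intro h0
  have : e = -s := eq_neg_of_add_eq_zero_left h0
  rw [this, norm_neg] at h; exact lt_irrefl _ h

/-- **One slope.** `‖c₄‖ = ϱ⁴`, `‖c₃‖, ‖c₂‖, ‖c₁‖ ≤ ϱ⁴`, `‖c₀‖ = 1`, `0 < ϱ < 1`: every root has `‖x‖·ϱ = 1`
(Newton polygon = the single segment `(0, 0) — (4, 4v(ϖ))`; the shape of `Ψ₃` on sub-row B). [folklore] -/
theorem norm_mul_eq_one_of_quartic_root_oneSlope {c₀ c₁ c₂ c₃ c₄ x : K} {ϱ : ℝ} (hϱ0 : 0 < ϱ) (hϱ1 : ϱ < 1)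
    (h4 : ‖c₄‖ = ϱ ^ 4) (h3 : ‖c₃‖ ≤ ϱ ^ 4) (h2 : ‖c₂‖ ≤ ϱ ^ 4) (h1 : ‖c₁‖ ≤ ϱ ^ 4) (h0 : ‖c₀‖ = 1)
    (hroot : c₄ * x ^ 4 + c₃ * x ^ 3 + c₂ * x ^ 2 + c₁ * x + c₀ = 0) : ‖x‖ * ϱ = 1 := by
  set r := ‖x‖ with hr
  have hr0 : 0 ≤ r := norm_nonneg x
  have hϱ4 : 0 < ϱ ^ 4 := pow_pos hϱ0 4
  have hT : ∀ (c : K) (j : ℕ), ‖c‖ ≤ ϱ ^ 4 → ‖c * x ^ j‖ ≤ ϱ ^ 4 * r ^ j := fun c j hc ↦ by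
    rw [norm_mul, norm_pow]; exact mul_le_mul_of_nonneg_right hc (pow_nonneg hr0 j)
  have hT4 : ‖c₄ * x ^ 4‖ = ϱ ^ 4 * r ^ 4 := by rw [norm_mul, norm_pow, h4]
  rcases lt_trichotomy (ϱ ^ 4 * r ^ 4) 1 with hlt | heq | hgt
  · -- the constant term is isolated dominant
    exfalso
    have hb : ∀ j, 1 ≤ j → j ≤ 4 → ϱ ^ 4 * r ^ j < 1 := by
      intro j hj1 hj4
      rcases le_or_gt r 1 with hr1 | hr1
      · exact (mul_le_of_le_one_right hϱ4.le (pow_le_one₀ hr0 hr1)).trans_lt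
          (pow_lt_one₀ hϱ0.le hϱ1 four_ne_zero)
      · exact (mul_le_mul_of_nonneg_left (pow_le_pow_right₀ hr1.le hj4) hϱ4.le).trans_lt hlt
    have hs : ‖c₄ * x ^ 4 + c₃ * x ^ 3 + c₂ * x ^ 2 + c₁ * x‖ < ‖c₀‖ := by
      rw [h0]
      have e1 : ‖c₁ * x‖ ≤ ϱ ^ 4 * r ^ 1 := by simpa using hT c₁ 1 h1
      have hM := norm_add₄_le
        (B := max (max (ϱ ^ 4 * r ^ 4) (ϱ ^ 4 * r ^ 3)) (max (ϱ ^ 4 * r ^ 2) (ϱ ^ 4 * r ^ 1)))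
        (hT4.le.trans (le_max_of_le_left (le_max_left _ _)))
        ((hT c₃ 3 h3).trans (le_max_of_le_left (le_max_right _ _)))
        ((hT c₂ 2 h2).trans (le_max_of_le_right (le_max_left _ _)))
        (e1.trans (le_max_of_le_right (le_max_right _ _)))
      exact hM.trans_lt (max_lt (max_lt (hb 4 (by norm_num) le_rfl) (hb 3 (by norm_num) (by norm_num)))
        (max_lt (hb 2 (by norm_num) (by norm_num)) (hb 1 le_rfl (by norm_num))))
    exact add_ne_zero_of_norm_lt (e := c₀) hs (by rw [← hroot]; ring)
  · have h : (r * ϱ) ^ 4 = 1 ^ 4 := by rw [mul_pow, one_pow, mul_comm]; exact heq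
    exact (pow_left_inj₀ (mul_nonneg hr0 hϱ0.le) zero_le_one four_ne_zero).mp h
  · -- the leading term is isolated dominant
    exfalso
    have hr1 : 1 < r := by
      by_contra h
      have : ϱ ^ 4 * r ^ 4 ≤ ϱ ^ 4 := mul_le_of_le_one_right hϱ4.le (pow_le_one₀ hr0 (not_lt.mp h))
      exact (lt_irrefl (1 : ℝ)) (hgt.trans_le (this.trans (pow_le_one₀ hϱ0.le hϱ1.le)))
    have hb : ∀ j, j < 4 → ϱ ^ 4 * r ^ j < ϱ ^ 4 * r ^ 4 := fun j hj ↦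
      mul_lt_mul_of_pos_left (pow_lt_pow_right₀ hr1 hj) hϱ4
    have hs : ‖c₃ * x ^ 3 + c₂ * x ^ 2 + c₁ * x + c₀‖ < ‖c₄ * x ^ 4‖ := by
      rw [hT4]
      have e1 : ‖c₁ * x‖ ≤ ϱ ^ 4 * r ^ 1 := by simpa using hT c₁ 1 h1
      have e0 : ‖c₀‖ < ϱ ^ 4 * r ^ 4 := by rw [h0]; exact hgt
      have hB := norm_add₄_le (B := max (max (ϱ ^ 4 * r ^ 3) (ϱ ^ 4 * r ^ 2)) (max (ϱ ^ 4 * r ^ 1) ‖c₀‖))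
        ((hT c₃ 3 h3).trans (le_max_of_le_left (le_max_left _ _)))
        ((hT c₂ 2 h2).trans (le_max_of_le_left (le_max_right _ _)))
        (e1.trans (le_max_of_le_right (le_max_left _ _))) (le_max_of_le_right (le_max_right _ _))
      exact hB.trans_lt (max_lt (max_lt (hb 3 (by norm_num)) (hb 2 (by norm_num))) (max_lt (hb 1 (by norm_num)) e0))
    have : c₄ * x ^ 4 + (c₃ * x ^ 3 + c₂ * x ^ 2 + c₁ * x + c₀) = 0 := by rw [← hroot]; ring
    exact add_ne_zero_of_norm_lt hs this

/-- **Two slopes.** `‖c₄‖ = ϱ⁴`, `‖c₃‖ = ϱ²`, `‖c₂‖, ‖c₁‖ ≤ ϱ⁴`, `‖c₀‖ = 1`, `0 < ϱ < 1`: every root has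
`‖x‖·ϱ² = 1` (ONE root: vertex `(3, 2v(ϖ)) — (4, 4v(ϖ))`) or `‖x‖³·ϱ² = 1` (THREE roots: `(0,0) — (3, 2v(ϖ))`);
the shape of `Ψ₃` on sub-row A. [folklore] -/
theorem norm_mul_eq_one_or_of_quartic_root_twoSlopes {c₀ c₁ c₂ c₃ c₄ x : K} {ϱ : ℝ} (hϱ0 : 0 < ϱ)
    (hϱ1 : ϱ < 1) (h4 : ‖c₄‖ = ϱ ^ 4) (h3 : ‖c₃‖ = ϱ ^ 2) (h2 : ‖c₂‖ ≤ ϱ ^ 4) (h1 : ‖c₁‖ ≤ ϱ ^ 4)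
    (h0 : ‖c₀‖ = 1) (hroot : c₄ * x ^ 4 + c₃ * x ^ 3 + c₂ * x ^ 2 + c₁ * x + c₀ = 0) :
    ‖x‖ * ϱ ^ 2 = 1 ∨ ‖x‖ ^ 3 * ϱ ^ 2 = 1 := by
  set r := ‖x‖ with hr
  have hr0 : 0 ≤ r := norm_nonneg x
  have hϱ4 : 0 < ϱ ^ 4 := pow_pos hϱ0 4
  have hϱ2 : 0 < ϱ ^ 2 := pow_pos hϱ0 2
  have hϱ21 : ϱ ^ 2 < 1 := pow_lt_one₀ hϱ0.le hϱ1 two_ne_zero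
  have hT : ∀ (c : K) (j : ℕ), ‖c‖ ≤ ϱ ^ 4 → ‖c * x ^ j‖ ≤ ϱ ^ 4 * r ^ j := fun c j hc ↦ by
    rw [norm_mul, norm_pow]; exact mul_le_mul_of_nonneg_right hc (pow_nonneg hr0 j)
  have hT4 : ‖c₄ * x ^ 4‖ = ϱ ^ 4 * r ^ 4 := by rw [norm_mul, norm_pow, h4]
  have hT3 : ‖c₃ * x ^ 3‖ = ϱ ^ 2 * r ^ 3 := by rw [norm_mul, norm_pow, h3]
  have e1 : ‖c₁ * x‖ ≤ ϱ ^ 4 * r := by simpa using hT c₁ 1 h1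
  have e2 : ‖c₂ * x ^ 2‖ ≤ ϱ ^ 4 * r ^ 2 := hT c₂ 2 h2
  -- `a = ϱ² r` (ratio `T₄/T₃`), `b = ϱ² r³` (`= T₃`); `T₄ = a·b`, `T₀ = 1`
  set a := ϱ ^ 2 * r with ha
  set b := ϱ ^ 2 * r ^ 3 with hb
  have hab : ϱ ^ 4 * r ^ 4 = a * b := by rw [ha, hb]; ring
  have ha0 : 0 ≤ a := by positivity
  have hb0 : 0 ≤ b := by positivity
  by_cases hA : a = 1
  · left; rw [mul_comm]; exact hA
  by_cases hB : b = 1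
  · right; rw [mul_comm]; exact hB
  exfalso
  -- three regions, each with an isolated dominant term
  by_cases hb1 : b < 1
  · by_cases hab1 : a * b < 1
    · -- dominant: the constant term
      have hr2 : ϱ ^ 2 * r ^ 2 < 1 := by
        have : (ϱ ^ 2 * r ^ 2) ^ 2 = a * b := by rw [ha, hb]; ring
        nlinarith [mul_nonneg hϱ2.le (pow_nonneg hr0 2)]
      have hr1' : ϱ * r < 1 := by
        have : (ϱ * r) ^ 2 = ϱ ^ 2 * r ^ 2 := by ring
        nlinarith [mul_nonneg hϱ0.le hr0]
      have i2 : ϱ ^ 4 * r ^ 2 < 1 := by nlinarith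
      have i1 : ϱ ^ 4 * r < 1 := by nlinarith [pow_pos hϱ0 3]
      have hs : ‖c₄ * x ^ 4 + c₃ * x ^ 3 + c₂ * x ^ 2 + c₁ * x‖ < ‖c₀‖ := by
        rw [h0]
        have hM := norm_add₄_le (B := max (max (a * b) b) (max (ϱ ^ 4 * r ^ 2) (ϱ ^ 4 * r)))
          ((hT4.trans hab).le.trans (le_max_of_le_left (le_max_left _ _)))
          (hT3.le.trans (le_max_of_le_left (le_max_right _ _)))
          (e2.trans (le_max_of_le_right (le_max_left _ _))) (e1.trans (le_max_of_le_right (le_max_right _ _)))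
        exact hM.trans_lt (max_lt (max_lt hab1 hb1) (max_lt i2 i1))
      exact add_ne_zero_of_norm_lt (e := c₀) hs (by rw [← hroot]; ring)
    · -- `a·b ≥ 1 > b` forces `a > 1`, `r = …`: impossible region (`ab = 1` ⇒ `r = ϱ⁻¹` ⇒ `b = ϱ⁻¹ > 1`)
      have hab' : 1 ≤ a * b := not_lt.mp hab1
      -- from `b < 1 ≤ ab`: `a > 1`, i.e. `ϱ² r > 1`, so `r > ϱ⁻²`; then `b = ϱ² r³ > ϱ⁻⁴ > 1`
      have ha1 : 1 < a := by
        by_contra h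
        have : a * b ≤ 1 * b := mul_le_mul_of_nonneg_right (not_lt.mp h) hb0
        linarith
      have : 1 < b := by
        -- `b = a³ / ϱ⁴ ≥ a³ > 1`
        have hb' : b * ϱ ^ 4 = a ^ 3 := by rw [ha, hb]; ring
        have ha3 : 1 < a ^ 3 := one_lt_pow₀ ha1 three_ne_zero
        have : b * ϱ ^ 4 ≤ b := mul_le_of_le_one_right hb0 (pow_le_one₀ hϱ0.le hϱ1.le)
        linarith
      linarith
  · have hb1' : 1 < b := lt_of_le_of_ne (not_lt.mp hb1) (Ne.symm hB)
    have hr1 : 1 < r := by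
      by_contra h
      have : b ≤ ϱ ^ 2 := by
        rw [hb]; exact mul_le_of_le_one_right hϱ2.le (pow_le_one₀ hr0 (not_lt.mp h))
      linarith
    by_cases ha1 : a < 1
    · -- dominant: the cubic term
      have i4 : ϱ ^ 4 * r ^ 4 < ϱ ^ 2 * r ^ 3 := by
        rw [hab, ← hb]; exact mul_lt_of_lt_one_left (by linarith) ha1
      have i2 : ϱ ^ 4 * r ^ 2 < ϱ ^ 2 * r ^ 3 := by
        have : ϱ ^ 2 < r := hϱ21.trans hr1
        nlinarith [mul_pos hϱ2 (pow_pos (zero_lt_one.trans hr1) 2)]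
      have i1 : ϱ ^ 4 * r < ϱ ^ 2 * r ^ 3 := by
        have : ϱ ^ 2 < r ^ 2 := hϱ21.trans (one_lt_pow₀ hr1 two_ne_zero)
        nlinarith [mul_pos hϱ2 (zero_lt_one.trans hr1)]
      have i0 : ‖c₀‖ < ϱ ^ 2 * r ^ 3 := by rw [h0]; exact hb1'
      have hs : ‖c₄ * x ^ 4 + c₂ * x ^ 2 + c₁ * x + c₀‖ < ‖c₃ * x ^ 3‖ := by
        rw [hT3]
        have hM := norm_add₄_le (B := max (max (ϱ ^ 4 * r ^ 4) (ϱ ^ 4 * r ^ 2)) (max (ϱ ^ 4 * r) ‖c₀‖))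
          (hT4.le.trans (le_max_of_le_left (le_max_left _ _)))
          (e2.trans (le_max_of_le_left (le_max_right _ _)))
          (e1.trans (le_max_of_le_right (le_max_left _ _))) (le_max_of_le_right (le_max_right _ _))
        exact hM.trans_lt (max_lt (max_lt i4 i2) (max_lt i1 i0))
      exact add_ne_zero_of_norm_lt (e := c₃ * x ^ 3) hs (by rw [← hroot]; ring)
    · -- dominant: the leading term
      have ha1' : 1 < a := lt_of_le_of_ne (not_lt.mp ha1) (Ne.symm hA)
      have i3 : ϱ ^ 2 * r ^ 3 < ϱ ^ 4 * r ^ 4 := by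
        rw [hab, ← hb]; exact lt_mul_of_one_lt_left (by linarith) ha1'
      have i2 : ϱ ^ 4 * r ^ 2 < ϱ ^ 4 * r ^ 4 :=
        mul_lt_mul_of_pos_left (pow_lt_pow_right₀ hr1 (by norm_num)) hϱ4
      have i1 : ϱ ^ 4 * r < ϱ ^ 4 * r ^ 4 := by
        have := mul_lt_mul_of_pos_left (pow_lt_pow_right₀ hr1 (by norm_num : 1 < 4)) hϱ4
        simpa using this
      have i0 : ‖c₀‖ < ϱ ^ 4 * r ^ 4 := by rw [h0]; linarith
      have hs : ‖c₃ * x ^ 3 + c₂ * x ^ 2 + c₁ * x + c₀‖ < ‖c₄ * x ^ 4‖ := by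
        rw [hT4]
        have hM := norm_add₄_le (B := max (max (ϱ ^ 2 * r ^ 3) (ϱ ^ 4 * r ^ 2)) (max (ϱ ^ 4 * r) ‖c₀‖))
          (hT3.le.trans (le_max_of_le_left (le_max_left _ _)))
          (e2.trans (le_max_of_le_left (le_max_right _ _)))
          (e1.trans (le_max_of_le_right (le_max_left _ _))) (le_max_of_le_right (le_max_right _ _))
        exact hM.trans_lt (max_lt (max_lt i3 i2) (max_lt i1 i0))
      exact add_ne_zero_of_norm_lt (e := c₄ * x ^ 4) hs (by rw [← hroot]; ring)

end Quartic

end Summit.BirchSwinnertonDyer.BirchSwinnertonDyer.Theorems.SolventPairLowerBound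

end
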